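import Summits.NavierStokesRegularity.FunctionalMining.StretchingLowerCellularProfiles
import HarnessLib

/-!
# K1-Q1 lower side in the kernel: cellular fields, part 2 — the field and its first derivatives

Cell `pub-nsfunc`, prove seat gen 5, on `pub-nsfunc-bank/K1Q1-HALF.md` Thm 1. **Search for candidate a priori estimates; no regularity claim.** Static field facts only; nothing is
asserted about Navier–Stokes solutions or their regularity.

This file: the calculus of functions `P(n₀y₀ + n₁y₁)` on `T²` (smoothness, `∂_r = n_r P'`), the crossed-shear base
flow `V(y) = (Q(y₁), −Q(y₀))` (smooth, divergence free, `∂₀V = (0, −Q'(y₀))`, `∂₁V = (Q'(y₁), 0)`), the envelopes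
`E_A = η₊(y₀)η₋(y₁)`, `E_B = η₋(y₀)η₊(y₁)`, the vertical component `w = E_A·H(y₀+y₁) + E_B·H(y₀−y₁)` with its two
partial derivatives, the field `u = twoHalf V w` on `T³`, and the three pointwise identities used downstream:
the orthogonality-form integrand `∑ₘ∑ᵢ ∂ₘuᵢ⟪∂ₘu, ∂ᵢu⟫ = (Q'(y₁) − Q'(y₀))∂₀w∂₁w`,
`∑ᵢ‖∂ᵢu‖² = Q'(y₀)² + Q'(y₁)² + |∇w|²`, `|ω|² = (Q'(y₀) + Q'(y₁))² + |∇w|²`.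
-/

noncomputable section

open MeasureTheory Set Filter Topology Function
open scoped InnerProductSpace ContDiff

namespace Summit.NavierStokesRegularity.FunctionalMining

open Literature.Analysis Literature.Analysis.FunctionSpaces Literature.Analysis.FunctionSpaces.Torus
open Literature.Analysis.FluidPDE Literature.Analysis.FluidPDE.Torus

namespace CellularStretching

/-! ## 3. Functions `P(n₀y₀ + n₁y₁)` on `T²` -/

/-- `y ↦ P(n₀y₀ + n₁y₁)` on `T²`, for a profile `P` and integers `n₀, n₁`. [ours; bookkeeping] -/
def coordForm (n₀ n₁ : ℤ) (P : ShearProfile) (y : UnitAddTorus (Fin 2)) : ℝ :=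
  P.onCircle (n₀ • y 0 + n₁ • y 1)

/-- Values on the covering plane. [folklore] -/
theorem coordForm_proj (n₀ n₁ : ℤ) (P : ShearProfile) (z : EuclideanSpace ℝ (Fin 2)) :
    coordForm n₀ n₁ P (proj z) = P (n₀ * z 0 + n₁ * z 1) := by
  rw [coordForm, proj_apply, proj_apply, ← AddCircle.coe_zsmul, ← AddCircle.coe_zsmul, ← AddCircle.coe_add,
    ShearProfile.onCircle_coe, zsmul_eq_mul, zsmul_eq_mul]

/-- `coordForm 1 0 P y = P(y₀)`. [folklore] -/
@[simp] theorem coordForm_one_zero (P : ShearProfile) (y : UnitAddTorus (Fin 2)) :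
    coordForm 1 0 P y = P.onCircle (y 0) := by simp [coordForm]

/-- `coordForm 0 1 P y = P(y₁)`. [folklore] -/
@[simp] theorem coordForm_zero_one (P : ShearProfile) (y : UnitAddTorus (Fin 2)) :
    coordForm 0 1 P y = P.onCircle (y 1) := by simp [coordForm]

/-- `coordForm 1 1 P y = P(y₀ + y₁)`. [folklore] -/
@[simp] theorem coordForm_one_one (P : ShearProfile) (y : UnitAddTorus (Fin 2)) :
    coordForm 1 1 P y = P.onCircle (y 0 + y 1) := by simp [coordForm]

/-- `coordForm 1 (−1) P y = P(y₀ − y₁)`. [folklore] -/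
@[simp] theorem coordForm_one_neg_one (P : ShearProfile) (y : UnitAddTorus (Fin 2)) :
    coordForm 1 (-1) P y = P.onCircle (y 0 - y 1) := by simp [coordForm, sub_eq_add_neg]

/-- `y ↦ P(n₀y₀ + n₁y₁)` is smooth. [folklore] -/
theorem isSmooth_coordForm (n₀ n₁ : ℤ) (P : ShearProfile) : IsSmooth (coordForm n₀ n₁ P) := by
  unfold IsSmooth lift
  have : (coordForm n₀ n₁ P ∘ proj) = fun z : EuclideanSpace ℝ (Fin 2) => P (n₀ * z 0 + n₁ * z 1) := by
    funext z; exact coordForm_proj n₀ n₁ P z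
  rw [this]
  exact P.contDiff.comp
    ((contDiff_const.mul (EuclideanSpace.proj (0 : Fin 2) : EuclideanSpace ℝ (Fin 2) →L[ℝ] ℝ).contDiff).add
      (contDiff_const.mul (EuclideanSpace.proj (1 : Fin 2) : EuclideanSpace ℝ (Fin 2) →L[ℝ] ℝ).contDiff))

/-- `C¹` bookkeeping. [folklore] -/
theorem isContDiff_coordForm (n₀ n₁ : ℤ) (P : ShearProfile) : IsContDiff 1 (coordForm n₀ n₁ P) :=
  (isSmooth_coordForm n₀ n₁ P).isContDiff (by simp)

/-- Continuity bookkeeping. [folklore] -/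
theorem continuous_coordForm (n₀ n₁ : ℤ) (P : ShearProfile) : Continuous (coordForm n₀ n₁ P) :=
  (isSmooth_coordForm n₀ n₁ P).continuous

/-- `d/dt|₀ P(c + t n) = n P'(c)`. [folklore] -/
theorem deriv_comp_affine (P : ShearProfile) (c n : ℝ) :
    deriv (fun t : ℝ => P (c + t * n)) 0 = n * deriv P c := by
  have h1 : HasDerivAt (fun t : ℝ => c + t * n) n 0 := by
    simpa using ((hasDerivAt_id (0 : ℝ)).mul_const n).const_add c
  have h2 : HasDerivAt P (deriv P c) (c + 0 * n) := by
    rw [zero_mul, add_zero]; exact hasDerivAt_profile P c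
  have h := h2.comp 0 h1
  rw [show deriv P c * n = n * deriv P c from mul_comm _ _] at h
  exact h.deriv

/-- **Partial derivatives of `P(n₀y₀ + n₁y₁)`**: `∂_r = n_r · P'(n₀y₀ + n₁y₁)`. [folklore] -/
theorem partialDeriv_coordForm (n₀ n₁ : ℤ) (P : ShearProfile) (r : Fin 2) (y : UnitAddTorus (Fin 2)) :
    Torus.partialDeriv r (coordForm n₀ n₁ P) y =
      (if r = 0 then (n₀ : ℝ) else n₁) * coordForm n₀ n₁ P.D y := by
  obtain ⟨z, rfl⟩ := proj_surjective y
  unfold Torus.partialDeriv Torus.lineDeriv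
  have harg : ∀ t : ℝ, proj z + proj (t • EuclideanSpace.single r (1 : ℝ)) =
      proj (z + t • EuclideanSpace.single r 1) := fun t => (proj_add _ _).symm
  simp_rw [harg, coordForm_proj, ShearProfile.D_apply]
  have hfun : (fun t : ℝ => P (n₀ * (z + t • EuclideanSpace.single r (1 : ℝ)) 0 +
      n₁ * (z + t • EuclideanSpace.single r (1 : ℝ)) 1)) =
      fun t => P ((n₀ * z 0 + n₁ * z 1) + t * (if r = 0 then (n₀ : ℝ) else n₁)) := by
    funext t
    congr 1
    by_cases hr : r = 0
    · subst hr; simp; ring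
    · obtain rfl : r = 1 := Fin.eq_one_of_ne_zero r hr
      simp; ring
  rw [hfun, deriv_comp_affine]

/-- The derivative profile of `−P` is `−P'` on the circle. [folklore] -/
theorem neg_D_onCircle (P : ShearProfile) (b : UnitAddCircle) : P.neg.D.onCircle b = -P.D.onCircle b := by
  obtain ⟨t, rfl⟩ := QuotientAddGroup.mk_surjective b
  rw [ShearProfile.onCircle_coe, ShearProfile.onCircle_coe, ShearProfile.D_apply, ShearProfile.D_apply]
  change deriv (fun s => -P s) t = -deriv P t
  exact deriv.neg

/-- A uniform bound on `deriv P` bounds `P'` on the circle. [folklore] -/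
theorem abs_D_onCircle_le {P : ShearProfile} {M : ℝ} (hM : ∀ t, |deriv P t| ≤ M) (b : UnitAddCircle) :
    |P.D.onCircle b| ≤ M := by
  obtain ⟨t, rfl⟩ := QuotientAddGroup.mk_surjective b
  rw [ShearProfile.onCircle_coe, ShearProfile.D_apply]; exact hM t

/-- A uniform bound on `P` bounds it on the circle. [folklore] -/
theorem abs_onCircle_le {P : ShearProfile} {M : ℝ} (hM : ∀ t, |P t| ≤ M) (b : UnitAddCircle) :
    |P.onCircle b| ≤ M := by
  obtain ⟨t, rfl⟩ := QuotientAddGroup.mk_surjective b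
  rw [ShearProfile.onCircle_coe]; exact hM t

/-- Membership bounds transfer to the circle. [folklore] -/
theorem onCircle_mem {P : ShearProfile} {s : Set ℝ} (hM : ∀ t, P t ∈ s) (b : UnitAddCircle) :
    P.onCircle b ∈ s := by
  obtain ⟨t, rfl⟩ := QuotientAddGroup.mk_surjective b
  rw [ShearProfile.onCircle_coe]; exact hM t

/-- Partial derivatives of constants vanish. [folklore] -/
theorem partialDeriv_const_eq_zero {F : Type*} [NormedAddCommGroup F] [NormedSpace ℝ F] (c : F)
    (r : Fin 2) (y : UnitAddTorus (Fin 2)) : Torus.partialDeriv r (fun _ : UnitAddTorus (Fin 2) => c) y = 0 := by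
  unfold Torus.partialDeriv Torus.lineDeriv; simp

/-- Products of `C¹` scalar functions are `C¹` (bookkeeping form). [folklore] -/
theorem isContDiff_mul {a b : UnitAddTorus (Fin 2) → ℝ} (ha : IsContDiff 1 a) (hb : IsContDiff 1 b) :
    IsContDiff 1 (fun y => a y * b y) := ContDiff.mul ha hb

/-- `y ↦ a(y) • v` is `C¹` for a `C¹` scalar `a` and a constant vector `v`. [folklore] -/
theorem isContDiff_smul_const {a : UnitAddTorus (Fin 2) → ℝ} (ha : IsContDiff 1 a)
    (v : EuclideanSpace ℝ (Fin 2)) : IsContDiff 1 (fun y => a y • v) :=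
  ContDiff.smul ha (isContDiff_const (d := Fin 2) (n := 1) v)

/-! ## 4. The cellular field `u = (S(x₁), −S(x₀), w(x₀,x₁))` on `T³` -/

section Field

variable (Q N H : ShearProfile)

/-- **The crossed-shear base flow** `V(y) = (Q(y₁), −Q(y₀))` on `T²`. [ours] -/
def V (Q : ShearProfile) (y : UnitAddTorus (Fin 2)) : EuclideanSpace ℝ (Fin 2) :=
  coordForm 0 1 Q y • EuclideanSpace.single 0 (1 : ℝ) + coordForm 1 0 Q.neg y • EuclideanSpace.single 1 (1 : ℝ)

/-- **Envelope of the cells `A = {Q'(y₀) = 1, Q'(y₁) = −1}`**: `E_A(y) = η₊(y₀)η₋(y₁)`, `η₊ = η₋(· + ½)`. [ours] -/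
def EA (N : ShearProfile) (y : UnitAddTorus (Fin 2)) : ℝ :=
  coordForm 1 0 (shift N 2⁻¹) y * coordForm 0 1 N y

/-- **Envelope of the cells `B = {Q'(y₀) = −1, Q'(y₁) = 1}`**: `E_B(y) = η₋(y₀)η₊(y₁)`. [ours] -/
def EB (N : ShearProfile) (y : UnitAddTorus (Fin 2)) : ℝ :=
  coordForm 1 0 N y * coordForm 0 1 (shift N 2⁻¹) y

/-- **The vertical component** `w(y) = E_A(y)·H(y₀ + y₁) + E_B(y)·H(y₀ − y₁)`: waves aligned with the
stretching direction of each strain cell. [ours] -/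
def w (N H : ShearProfile) (y : UnitAddTorus (Fin 2)) : ℝ :=
  EA N y * coordForm 1 1 H y + EB N y * coordForm 1 (-1) H y

/-- **The cellular field** `u = (Q(x₁), −Q(x₀), w(x₀, x₁))` on `T³`. [ours] -/
def u (Q N H : ShearProfile) : UnitAddTorus (Fin 3) → EuclideanSpace ℝ (Fin 3) := twoHalf (V Q) (w N H)

/-- `V` is smooth. [ours; elementary] -/
theorem isSmooth_V : IsSmooth (V Q) :=
  ((isSmooth_coordForm 0 1 Q).smul' (isSmooth_const _)).add ((isSmooth_coordForm 1 0 Q.neg).smul' (isSmooth_const _))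

/-- `E_A` is smooth. [ours; elementary] -/
theorem isSmooth_EA : IsSmooth (EA N) :=
  (isSmooth_coordForm 1 0 (shift N 2⁻¹)).mul (isSmooth_coordForm 0 1 N)

/-- `E_B` is smooth. [ours; elementary] -/
theorem isSmooth_EB : IsSmooth (EB N) :=
  (isSmooth_coordForm 1 0 N).mul (isSmooth_coordForm 0 1 (shift N 2⁻¹))

/-- `w` is smooth. [ours; elementary] -/
theorem isSmooth_w : IsSmooth (w N H) :=
  ((isSmooth_EA N).mul (isSmooth_coordForm 1 1 H)).add ((isSmooth_EB N).mul (isSmooth_coordForm 1 (-1) H))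

/-- **`u` is smooth.** [ours] -/
theorem isSmooth_u : IsSmooth (u Q N H) := (isSmooth_V Q).twoHalf (isSmooth_w N H)

/-- `C¹` bookkeeping. [folklore] -/
theorem isContDiff_V : IsContDiff 1 (V Q) := (isSmooth_V Q).isContDiff (by simp)
/-- `C¹` bookkeeping. [folklore] -/
theorem isContDiff_w : IsContDiff 1 (w N H) := (isSmooth_w N H).isContDiff (by simp)
/-- `C¹` bookkeeping. [folklore] -/
theorem isContDiff_EA : IsContDiff 1 (EA N) := (isSmooth_EA N).isContDiff (by simp)
/-- `C¹` bookkeeping. [folklore] -/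
theorem isContDiff_EB : IsContDiff 1 (EB N) := (isSmooth_EB N).isContDiff (by simp)

/-- **`V` is divergence free** (`∂₀` of `Q(y₁)` and `∂₁` of `−Q(y₀)` vanish). [ours; elementary] -/
theorem isDivFree_V : IsDivFree (V Q) := by
  intro y
  unfold Torus.divergence
  have h0 : (fun y => V Q y 0) = coordForm 0 1 Q := by funext y; simp [V]
  have h1 : (fun y => V Q y 1) = coordForm 1 0 Q.neg := by funext y; simp [V]
  rw [Fin.sum_univ_two, h0, h1, partialDeriv_coordForm, partialDeriv_coordForm]
  simp

/-- **`u` is divergence free.** [ours] -/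
theorem isDivFree_u : IsDivFree (u Q N H) := (isDivFree_V Q).twoHalf (w N H)

/-- **`∂₀V(y) = (0, −Q'(y₀))`.** [ours; elementary] -/
theorem partialDeriv_zero_V (y : UnitAddTorus (Fin 2)) :
    Torus.partialDeriv 0 (V Q) y = (-Q.D.onCircle (y 0)) • EuclideanSpace.single 1 (1 : ℝ) := by
  have e : V Q = (fun y => coordForm 0 1 Q y • EuclideanSpace.single (0 : Fin 2) (1 : ℝ)) +
      fun y => coordForm 1 0 Q.neg y • EuclideanSpace.single (1 : Fin 2) (1 : ℝ) := rfl
  rw [e, partialDeriv_add (isContDiff_smul_const (isContDiff_coordForm 0 1 Q) _)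
    (isContDiff_smul_const (isContDiff_coordForm 1 0 Q.neg) _), Pi.add_apply,
    partialDeriv_smul (isContDiff_coordForm 0 1 Q) (isContDiff_const _),
    partialDeriv_smul (isContDiff_coordForm 1 0 Q.neg) (isContDiff_const _),
    partialDeriv_const_eq_zero, partialDeriv_const_eq_zero, partialDeriv_coordForm, partialDeriv_coordForm]
  simp [neg_D_onCircle]

/-- **`∂₁V(y) = (Q'(y₁), 0)`.** [ours; elementary] -/
theorem partialDeriv_one_V (y : UnitAddTorus (Fin 2)) :
    Torus.partialDeriv 1 (V Q) y = (Q.D.onCircle (y 1)) • EuclideanSpace.single 0 (1 : ℝ) := by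
  have e : V Q = (fun y => coordForm 0 1 Q y • EuclideanSpace.single (0 : Fin 2) (1 : ℝ)) +
      fun y => coordForm 1 0 Q.neg y • EuclideanSpace.single (1 : Fin 2) (1 : ℝ) := rfl
  rw [e, partialDeriv_add (isContDiff_smul_const (isContDiff_coordForm 0 1 Q) _)
    (isContDiff_smul_const (isContDiff_coordForm 1 0 Q.neg) _), Pi.add_apply,
    partialDeriv_smul (isContDiff_coordForm 0 1 Q) (isContDiff_const _),
    partialDeriv_smul (isContDiff_coordForm 1 0 Q.neg) (isContDiff_const _),
    partialDeriv_const_eq_zero, partialDeriv_const_eq_zero, partialDeriv_coordForm, partialDeriv_coordForm]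
  simp

/-- **`∂_r E_A`.** [ours; elementary] -/
theorem partialDeriv_EA (r : Fin 2) (y : UnitAddTorus (Fin 2)) :
    Torus.partialDeriv r (EA N) y =
      (if r = 0 then (shift N 2⁻¹).D.onCircle (y 0) * N.onCircle (y 1)
        else (shift N 2⁻¹).onCircle (y 0) * N.D.onCircle (y 1)) := by
  rw [show EA N = fun y => coordForm 1 0 (shift N 2⁻¹) y * coordForm 0 1 N y from rfl,
    partialDeriv_mul (isContDiff_coordForm _ _ _) (isContDiff_coordForm _ _ _),
    partialDeriv_coordForm, partialDeriv_coordForm]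
  by_cases hr : r = 0
  · subst hr; simp
  · obtain rfl : r = 1 := Fin.eq_one_of_ne_zero r hr
    simp

/-- **`∂_r E_B`.** [ours; elementary] -/
theorem partialDeriv_EB (r : Fin 2) (y : UnitAddTorus (Fin 2)) :
    Torus.partialDeriv r (EB N) y =
      (if r = 0 then N.D.onCircle (y 0) * (shift N 2⁻¹).onCircle (y 1)
        else N.onCircle (y 0) * (shift N 2⁻¹).D.onCircle (y 1)) := by
  rw [show EB N = fun y => coordForm 1 0 N y * coordForm 0 1 (shift N 2⁻¹) y from rfl,
    partialDeriv_mul (isContDiff_coordForm _ _ _) (isContDiff_coordForm _ _ _),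
    partialDeriv_coordForm, partialDeriv_coordForm]
  by_cases hr : r = 0
  · subst hr; simp
  · obtain rfl : r = 1 := Fin.eq_one_of_ne_zero r hr
    simp

/-- **`∂₀w = (∂₀E_A)H(y₀+y₁) + E_A H'(y₀+y₁) + (∂₀E_B)H(y₀−y₁) + E_B H'(y₀−y₁)`.** [ours; elementary] -/
theorem partialDeriv_zero_w (y : UnitAddTorus (Fin 2)) :
    Torus.partialDeriv 0 (w N H) y =
      (shift N 2⁻¹).D.onCircle (y 0) * N.onCircle (y 1) * H.onCircle (y 0 + y 1) +
        EA N y * H.D.onCircle (y 0 + y 1) +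
      (N.D.onCircle (y 0) * (shift N 2⁻¹).onCircle (y 1) * H.onCircle (y 0 - y 1) +
        EB N y * H.D.onCircle (y 0 - y 1)) := by
  rw [show w N H = (fun y => EA N y * coordForm 1 1 H y) + fun y => EB N y * coordForm 1 (-1) H y from rfl,
    partialDeriv_add (isContDiff_mul (isContDiff_EA N) (isContDiff_coordForm 1 1 H))
      (isContDiff_mul (isContDiff_EB N) (isContDiff_coordForm 1 (-1) H)), Pi.add_apply,
    partialDeriv_mul (isContDiff_EA N) (isContDiff_coordForm 1 1 H),
    partialDeriv_mul (isContDiff_EB N) (isContDiff_coordForm 1 (-1) H),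
    partialDeriv_coordForm, partialDeriv_coordForm, partialDeriv_EA, partialDeriv_EB]
  simp only [if_true, coordForm_one_one, coordForm_one_neg_one]
  push_cast
  ring

/-- **`∂₁w = (∂₁E_A)H(y₀+y₁) + E_A H'(y₀+y₁) + (∂₁E_B)H(y₀−y₁) − E_B H'(y₀−y₁)`.** [ours; elementary] -/
theorem partialDeriv_one_w (y : UnitAddTorus (Fin 2)) :
    Torus.partialDeriv 1 (w N H) y =
      (shift N 2⁻¹).onCircle (y 0) * N.D.onCircle (y 1) * H.onCircle (y 0 + y 1) +
        EA N y * H.D.onCircle (y 0 + y 1) +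
      (N.onCircle (y 0) * (shift N 2⁻¹).D.onCircle (y 1) * H.onCircle (y 0 - y 1) -
        EB N y * H.D.onCircle (y 0 - y 1)) := by
  rw [show w N H = (fun y => EA N y * coordForm 1 1 H y) + fun y => EB N y * coordForm 1 (-1) H y from rfl,
    partialDeriv_add (isContDiff_mul (isContDiff_EA N) (isContDiff_coordForm 1 1 H))
      (isContDiff_mul (isContDiff_EB N) (isContDiff_coordForm 1 (-1) H)), Pi.add_apply,
    partialDeriv_mul (isContDiff_EA N) (isContDiff_coordForm 1 1 H),
    partialDeriv_mul (isContDiff_EB N) (isContDiff_coordForm 1 (-1) H),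
    partialDeriv_coordForm, partialDeriv_coordForm, partialDeriv_EA, partialDeriv_EB]
  simp only [show (1 : Fin 2) ≠ 0 from by decide, if_false, coordForm_one_one, coordForm_one_neg_one]
  push_cast
  ring

/-- **`∂₀u = (0, −Q'(y₀), ∂₀w)`** at `y = πx`. [ours; elementary] -/
theorem partialDeriv_zero_u (x : UnitAddTorus (Fin 3)) :
    Torus.partialDeriv 0 (u Q N H) x 0 = 0 ∧
    Torus.partialDeriv 0 (u Q N H) x 1 = -Q.D.onCircle (planarProj x 0) ∧
    Torus.partialDeriv 0 (u Q N H) x 2 = Torus.partialDeriv 0 (w N H) (planarProj x) := by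
  have h := partialDeriv_twoHalf_castSucc (isContDiff_V Q) (isContDiff_w N H) 0
  rw [show (Fin.castSucc (0 : Fin 2) : Fin 3) = 0 from rfl] at h
  rw [u, h]
  refine ⟨?_, ?_, ?_⟩
  · rw [show (0 : Fin 3) = Fin.castSucc (0 : Fin 2) from rfl, twoHalf_apply_castSucc, partialDeriv_zero_V]
    simp
  · rw [show (1 : Fin 3) = Fin.castSucc (1 : Fin 2) from rfl, twoHalf_apply_castSucc, partialDeriv_zero_V]
    simp
  · rw [twoHalf_apply_two]

/-- **`∂₁u = (Q'(y₁), 0, ∂₁w)`** at `y = πx`. [ours; elementary] -/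
theorem partialDeriv_one_u (x : UnitAddTorus (Fin 3)) :
    Torus.partialDeriv 1 (u Q N H) x 0 = Q.D.onCircle (planarProj x 1) ∧
    Torus.partialDeriv 1 (u Q N H) x 1 = 0 ∧
    Torus.partialDeriv 1 (u Q N H) x 2 = Torus.partialDeriv 1 (w N H) (planarProj x) := by
  have h := partialDeriv_twoHalf_castSucc (isContDiff_V Q) (isContDiff_w N H) 1
  rw [show (Fin.castSucc (1 : Fin 2) : Fin 3) = 1 from rfl] at h
  rw [u, h]
  refine ⟨?_, ?_, ?_⟩
  · rw [show (0 : Fin 3) = Fin.castSucc (0 : Fin 2) from rfl, twoHalf_apply_castSucc, partialDeriv_one_V]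
    simp
  · rw [show (1 : Fin 3) = Fin.castSucc (1 : Fin 2) from rfl, twoHalf_apply_castSucc, partialDeriv_one_V]
    simp
  · rw [twoHalf_apply_two]

/-- **`∂₂u = 0`**: the field is `2½`-dimensional. [ours; elementary] -/
theorem partialDeriv_two_u : Torus.partialDeriv 2 (u Q N H) = 0 := by
  rw [show (2 : Fin 3) = Fin.last 2 from rfl, u, partialDeriv_twoHalf_last]

/-- Inner products in `ℝ³` by coordinates. [folklore] -/
theorem inner_fin_three (v v' : EuclideanSpace ℝ (Fin 3)) : ⟪v, v'⟫_ℝ = v 0 * v' 0 + v 1 * v' 1 + v 2 * v' 2 := by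
  simp [PiLp.inner_apply, Fin.sum_univ_three, mul_comm]

/-- **The orthogonality-form integrand**: `∑ₘ∑ᵢ ∂ₘuᵢ ⟪∂ₘu, ∂ᵢu⟫ = (Q'(y₁) − Q'(y₀))·∂₀w·∂₁w` at `y = πx`.
[ours; elementary] -/
theorem orthForm_u (x : UnitAddTorus (Fin 3)) :
    ∑ m, ∑ i, Torus.partialDeriv m (u Q N H) x i *
        ⟪Torus.partialDeriv m (u Q N H) x, Torus.partialDeriv i (u Q N H) x⟫_ℝ =
      (Q.D.onCircle (planarProj x 1) - Q.D.onCircle (planarProj x 0)) *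
        Torus.partialDeriv 0 (w N H) (planarProj x) * Torus.partialDeriv 1 (w N H) (planarProj x) := by
  obtain ⟨h00, h01, h02⟩ := partialDeriv_zero_u Q N H x
  obtain ⟨h10, h11, h12⟩ := partialDeriv_one_u Q N H x
  have h2 := partialDeriv_two_u Q N H
  simp only [Fin.sum_univ_three, inner_fin_three, h00, h01, h02, h10, h11, h12, h2, Pi.zero_apply,
    PiLp.zero_apply]
  ring

/-- **`∑ᵢ ‖∂ᵢu‖² = Q'(y₀)² + Q'(y₁)² + (∂₀w)² + (∂₁w)²`** at `y = πx`. [ours; elementary] -/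
theorem sum_norm_sq_partialDeriv_u (x : UnitAddTorus (Fin 3)) :
    ∑ i, ‖Torus.partialDeriv i (u Q N H) x‖ ^ 2 =
      Q.D.onCircle (planarProj x 0) ^ 2 + Q.D.onCircle (planarProj x 1) ^ 2 +
        Torus.partialDeriv 0 (w N H) (planarProj x) ^ 2 + Torus.partialDeriv 1 (w N H) (planarProj x) ^ 2 := by
  obtain ⟨h00, h01, h02⟩ := partialDeriv_zero_u Q N H x
  obtain ⟨h10, h11, h12⟩ := partialDeriv_one_u Q N H x
  have h2 := partialDeriv_two_u Q N H
  simp only [Fin.sum_univ_three, EuclideanSpace.norm_sq_eq, Real.norm_eq_abs, sq_abs, h00, h01, h02,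
    h10, h11, h12, h2, Pi.zero_apply, PiLp.zero_apply]
  ring

/-- **`|ω|² = (Q'(y₀) + Q'(y₁))² + (∂₀w)² + (∂₁w)²`** at `y = πx`. [ours; elementary] -/
theorem torusVorticitySqAt_u (x : UnitAddTorus (Fin 3)) :
    torusVorticitySqAt (u Q N H) x =
      (Q.D.onCircle (planarProj x 0) + Q.D.onCircle (planarProj x 1)) ^ 2 +
        Torus.partialDeriv 0 (w N H) (planarProj x) ^ 2 + Torus.partialDeriv 1 (w N H) (planarProj x) ^ 2 := by
  obtain ⟨h00, h01, h02⟩ := partialDeriv_zero_u Q N H x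
  obtain ⟨h10, h11, h12⟩ := partialDeriv_one_u Q N H x
  have h2 := partialDeriv_two_u Q N H
  unfold torusVorticitySqAt
  simp only [Fin.sum_univ_three, h00, h01, h02, h10, h11, h12, h2, Pi.zero_apply, PiLp.zero_apply]
  ring

end Field

end CellularStretching

end Summit.NavierStokesRegularity.FunctionalMining

end
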